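import Mathlib
import Literature.Computability.AlgebraicComplexity.NewtonPolygonTau

/-!
# Typed exhibits of STRATEGY-CENSUS.md (gen 2) — crux `NewtonTauWeak` (stmt-ValiantsHypothesis-5904)

Statements only (census exhibits, not items): the retarget hierarchy above the ROOT form
(`KPTT.newtonTauRoot`, whose transfer is PROVED in `StrategistGen2Retarget.lean`), the ray/dual shape of
§Strengthen S-M, the `n`-variate form of S-I, and the explicit identity behind the depth counterexample of
§Decomposition D-H.  Everything elaborates; the one `theorem` is a `ring` identity.
-/

noncomputable section

namespace Literature.Computability.AlgebraicComplexity.KPTT.StrategistGen2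

open scoped BigOperators
open MvPolynomial

/-- POWER retarget `P(δ)` at `δ = 1/2` is `newtonTauRoot`; here the general member with exponent
`b·⌈m^{(c-1)/c}⌉`-type growth is rendered through `c`-th roots: `(kt+2)^{b (m / ⌊m^{1/c}⌋ + 1)}`
(`c = 2` is the root form up to rounding).  Admissible for the permanent transfer for every fixed `c ≥ 2`
(census S-J: `(kt)`-exponent `m^{1-δ}`, any `δ > 0`). -/
def newtonTauPower (c : ℕ) : Prop :=
  ∃ a b : ℕ, ∀ (k m t : ℕ) (f : Fin k → Fin m → MvPolynomial (Fin 2) ℂ),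
    (∀ i j, (f i j).support.card ≤ t) →
      newtonVertexCount (∑ i, ∏ j, f i j) ≤
        2 ^ (a * m) * (k * t + 2) ^ (b * (m / (Nat.nthRoot c m + 1) + 1))

/-- SUBEXP retarget — the transfer THRESHOLD (census S-J): for EVERY `A`, some `a, b` with
`#vert ≤ 2^{am} (kt+2)^{b + m/(A·log₂ m + 1)}`.  Weakest Newton-type statement known to this census that still
puts `PER ∉ VP_ℂ` (the `∀ A` is essential: the depth-reduction constant `C` of the transfer instance depends on
the hypothetical circuit exponent of the permanent, and the instance needs `A > 4C²`).  Any bound of CONVEXITY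
shape `k·t^{cm}`, `c > 0` (KPTT Thms 4–6, and necessarily `c ≥ 1/3` by KPTT Prop. 1) violates it. -/
def newtonTauSubexp : Prop :=
  ∀ A : ℕ, ∃ a b : ℕ, ∀ (k m t : ℕ) (f : Fin k → Fin m → MvPolynomial (Fin 2) ℂ),
    (∀ i j, (f i j).support.card ≤ t) →
      newtonVertexCount (∑ i, ∏ j, f i j) ≤
        2 ^ (a * m) * (k * t + 2) ^ (b + m / (A * Nat.log 2 m + 1))

/-- §Strengthen S-M — the RAY (dual) shape: `K` products of `t` univariate polynomials of degree `≤ m`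
composed with monomials `X^{v_{ls}}`, charged `2^{O(m)} poly(K t)`.  It is what Fischer + duality turn the
crux into (`K = k(mt+1)` groups, rays `= supp g_i`, degree `m`); its `m = 1` slice (linear `G`, i.e. binomial
factors `α + β X^v`, bound `2^a (Kt+2)^b = poly(K t)`) IS the live stub T2 (`BinomialNewtonTau`, free
exponents) — so the ray shape is T2-equivalent and yields no statement strictly between the crux and T2. -/
def RayBound (a b : ℕ) : Prop :=
  ∀ (K t m : ℕ) (v : Fin K → Fin t → (Fin 2 →₀ ℕ)) (G : Fin K → Fin t → Polynomial ℂ),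
    (∀ l s, (G l s).natDegree ≤ m) →
      newtonVertexCount (∑ l, ∏ s, Polynomial.aeval (monomial (v l s) (1 : ℂ)) (G l s)) ≤
        2 ^ (a * m) * (K * t + 2) ^ b

/-- §Strengthen S-I — the `n`-VARIATE form (vertices of the Newton polytope in `ℝⁿ`, budget `2^{a(m+n)}`).
Consistent at `k = 1` (a product of `m` simplices in independent coordinate subspaces has `t^m` vertices and
needs `n ≥ m(t-1)`); implies the crux at `n = 2`; no induction on `n` is available (projections lose vertices,
faces need initial forms of a signed sum). -/
def NewtonTauWeakN : Prop :=
  ∃ a b : ℕ, ∀ (n k m t : ℕ) (f : Fin k → Fin m → MvPolynomial (Fin n) ℂ),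
    (∀ i j, (f i j).support.card ≤ t) →
      (Set.extremePoints ℝ (convexHull ℝ ((fun e : Fin n →₀ ℕ => fun i : Fin n => ((e i : ℕ) : ℝ)) ''
        ((∑ i, ∏ j, f i j).support : Set (Fin n →₀ ℕ))))).ncard ≤ 2 ^ (a * (m + n)) * (k * t + 2) ^ b

/-- §Decomposition D-H — the identity behind the DEPTH counterexample: two products of two factors,
`A·B + (−A)·(B − c·X^e) = c·X^e·A`.  With `B` `t`-sparse and `X^e` a monomial deep inside `Newt(B)` (in the
normal directions of a vertex of `A`), the vertices `e + vert(A)` of the sum lie `Ω(t)` points below the formal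
supports `supp(AB) ∪ supp(A(B − cX^e))`: cancellation depth is unbounded at `k = m = 2` while `#vert ≤ t`. -/
theorem depth_counterexample_identity {R : Type*} [CommRing R] (A B M : R) :
    A * B + (-A) * (B - M) = M * A := by ring

end Literature.Computability.AlgebraicComplexity.KPTT.StrategistGen2
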